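import Summits.HubbardSuperconductivity.HubbardSuperconductivity.Theorems.AnisotropyChordTransferFerroGapReduction
import Summits.HubbardSuperconductivity.HubbardSuperconductivity.Theorems.AnisotropyChordTransferTorusPoincare
import Literature.RepresentationTheory.FiniteGroups.InterchangeSpectralGap

/-!
# Route `AnisotropyChord` / H0 rotor rung, route (1): THE SYMMETRIC EXCLUSION PROCESS HAS (AT LEAST) THE RANDOM-WALK GAP,
# and `FerroSectorGapCLR` HOLDS

The theorem of Caputo–Liggett–Richthammer (Aldous' spectral-gap conjecture; tree:
`Literature.RepresentationTheory.FiniteGroups.clr_spectralGap`, the interchange process on a weighted graph has the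
random-walk gap, in Dirichlet-form language on `𝔖_N`) is pushed down to the symmetric EXCLUSION process — the
projection of the interchange (stirring) process that only remembers which sites are occupied (Liggett 1985, Ch. VIII):

* `exclusion_poincare_of_rw_gap` — on any finite simple graph `G` on `V` (`|V| ≥ 2`): if every mean-zero one-particle
  function obeys `t Σ_x ‖g x‖² ≤ ¼ Σ_x Σ_y [x ∼ y] ‖g x − g y‖²`, then every real amplitude `ψ` on configurations
  `V → Fin 2` supported on one particle-number sector and with `Σ_σ ψ σ = 0` obeys `t Σ ψ² ≤ ⟨ψ, A ψ⟩`,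
  `A = fmOp G = ½ Σ_{edges} (1 − T_xy)` (tree `inner_fmOp_eq`).  Proof: label the particles of a reference
  configuration, lift `ψ` to `f(τ) = ψ(σ₁ ∘ e⁻¹ ∘ τ⁻¹ ∘ e)` on `𝔖_N` (`e : V ≃ Fin N`); a transposition of sites acts on
  `f` as the site swap on configurations; the fibres of the lift have constant size on the sector (a transposition-
  invariant count, `const_on_sector_of_swapInvariant`), so mean, norm and Dirichlet form of `f` are the same multiple
  of those of `ψ`; apply `clr_spectralGap` with rates `a_{ij} = ½ [e⁻¹ i ∼ e⁻¹ j]` and `le_gapRW`.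
* `exclusionGap_torus` — with the one-particle Poincaré inequality of the torus (`torus_poincare_adj`):
  `(1 − cos(2π/L)) Σ ψ² ≤ ⟨ψ, A ψ⟩` on `(ℤ/L)²`, `L ≥ 3`, in every sector.
* **`ferroSectorGapCLR_holds : FerroSectorGapCLR`** — by `sectorGapAtLeast_one_of_exclusionGap`: the named hypothesis
  of PART N19 (`…TransferGapMonotone`) is a THEOREM; `nearEnd_of_ferroSectorGapCLR`, `twoMagnonFerroGap_of_CLR` become
  unconditional.

References: P. Caputo, T. M. Liggett, T. Richthammer, *Proof of Aldous' spectral gap conjecture*, J. Amer. Math. Soc. 23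
(2010) 831–851, Thm 1.1 and §1.2 (exclusion by projection); T. M. Liggett, *Interacting Particle Systems* (1985) VIII.
Prover seat `hubbard-h0-rotor-p1` g20; helper for the S-bridge dossier of stmt-HubbardSuperconductivity-19089.  No definition
is introduced; nothing here is a statement about the Hubbard model.
-/

set_option linter.dupNamespace false
set_option autoImplicit false

noncomputable section

open Finset
open Literature.MathematicalPhysics.QuantumLattice Literature.Probability.LatticeModels
open Literature.RepresentationTheory.FiniteGroups (l2NormSq transpDirichlet transpDirichlet_comm clr_spectralGap le_gapRW)
open Summit.HubbardSuperconductivity.HubbardSuperconductivity.Theorems.AnisotropyChord.InsertionEntropy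
open Summit.HubbardSuperconductivity.HubbardSuperconductivity.Theorems.AnisotropyChord.Tower

namespace Summit.HubbardSuperconductivity.HubbardSuperconductivity.Theorems.AnisotropyChord.Transfer

/-! ## A symmetric ordered-pair sum is twice the sum over `i < j` -/

/-- `Σ_i Σ_{j > i} F i j = ½ Σ_i Σ_j F i j` for a symmetric `F` with zero diagonal. [folklore] -/
theorem sum_sum_filter_lt_eq_half {N : ℕ} (F : Fin N → Fin N → ℝ) (hsymm : ∀ i j, F i j = F j i)
    (hdiag : ∀ i, F i i = 0) :
    (∑ i : Fin N, ∑ j : Fin N with i < j, F i j) = (1 / 2 : ℝ) * ∑ i, ∑ j, F i j := by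
  have hsplit : ∀ i j : Fin N, F i j = (if i < j then F i j else 0) + (if j < i then F i j else 0) := by
    intro i j
    rcases lt_trichotomy i j with hlt | rfl | hgt
    · rw [if_pos hlt, if_neg (not_lt.mpr hlt.le), add_zero]
    · rw [if_neg (lt_irrefl _), hdiag, add_zero]
    · rw [if_neg (not_lt.mpr hgt.le), if_pos hgt, zero_add]
  have hlt : ∑ i : Fin N, ∑ j : Fin N, (if i < j then F i j else 0) = ∑ i : Fin N, ∑ j : Fin N with i < j, F i j :=
    Finset.sum_congr rfl fun i _ => by rw [Finset.sum_filter]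
  have hgt : ∑ i : Fin N, ∑ j : Fin N, (if j < i then F i j else 0) = ∑ i : Fin N, ∑ j : Fin N with i < j, F i j := by
    rw [Finset.sum_comm]
    refine Finset.sum_congr rfl fun j _ => ?_
    rw [Finset.sum_filter]
    exact Finset.sum_congr rfl fun i _ => by rw [hsymm i j]
  have htot : ∑ i, ∑ j, F i j = 2 * ∑ i : Fin N, ∑ j : Fin N with i < j, F i j := by
    calc ∑ i, ∑ j, F i j
        = ∑ i : Fin N, ∑ j : Fin N, ((if i < j then F i j else 0) + (if j < i then F i j else 0)) :=
          Finset.sum_congr rfl fun i _ => Finset.sum_congr rfl fun j _ => hsplit i j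
      _ = 2 * ∑ i : Fin N, ∑ j : Fin N with i < j, F i j := by
          simp only [Finset.sum_add_distrib]
          rw [hlt, hgt, two_mul]
  rw [htot]
  ring

/-! ## Exclusion ≥ interchange ≥ random walk -/

section General

variable {V : Type} [Fintype V] [DecidableEq V] (G : SimpleGraph V) [DecidableRel G.Adj]

/-- **The symmetric exclusion process has at least the random-walk gap** (Caputo–Liggett–Richthammer by projection).
If `t` is a Poincaré constant of the one-particle walk with rate `½` per edge, i.e. `t Σ_x ‖g x‖² ≤ ¼ Σ_x Σ_y [x ∼ y] ‖g x − g y‖²`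
for all `g : V → ℂ` with `Σ g = 0`, then every real amplitude `ψ` on `V → Fin 2` supported on a single particle-number
sector `{zerosCard = n}` and with `Σ_σ ψ σ = 0` satisfies `t Σ_σ ψ σ² ≤ Σ_σ ψ σ (fmOp G ψ) σ`.
[cite: CaputoLiggettRichthammer2010, Theorem 1.1 and §1.2] -/
theorem exclusion_poincare_of_rw_gap (hV : 2 ≤ Fintype.card V) (t : ℝ)
    (hRW : ∀ g : V → ℂ, ∑ x, g x = 0 →
      t * ∑ x, ‖g x‖ ^ 2 ≤ (1 / 4 : ℝ) * ∑ x, ∑ y, (if G.Adj x y then ‖g x - g y‖ ^ 2 else 0))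
    (n : ℝ) (ψ : (V → Fin 2) → ℝ) (hsupp : ∀ σ, ψ σ ≠ 0 → zerosCard σ = n) (hmean : ∑ σ, ψ σ = 0) :
    t * ∑ σ, ψ σ ^ 2 ≤ ∑ σ, ψ σ * fmOp G ψ σ := by
  classical
  -- the zero amplitude
  by_cases hψ0 : ∀ σ, ψ σ = 0
  · have h1 : ∑ σ, ψ σ ^ 2 = 0 := Finset.sum_eq_zero fun σ _ => by rw [hψ0 σ]; ring
    rw [h1, mul_zero]
    exact inner_fmOp_nonneg G ψ
  push Not at hψ0
  obtain ⟨σ₁, hσ₁⟩ := hψ0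
  have hn : zerosCard σ₁ = n := hsupp σ₁ hσ₁
  have hψoff : ∀ σ, zerosCard σ ≠ n → ψ σ = 0 := fun σ hσ => by
    by_contra h
    exact hσ (hsupp σ h)
  -- enumerate the sites
  set N : ℕ := Fintype.card V with hN
  let e : V ≃ Fin N := Fintype.equivFin V
  have hconj : ∀ (i j : Fin N) (v : V), e (Equiv.swap (e.symm i) (e.symm j) v) = Equiv.swap i j (e v) := by
    intro i j v
    rcases eq_or_ne v (e.symm i) with h1 | h1
    · subst h1
      rw [Equiv.swap_apply_left, Equiv.apply_symm_apply, Equiv.apply_symm_apply, Equiv.swap_apply_left]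
    · rcases eq_or_ne v (e.symm j) with h2 | h2
      · subst h2
        rw [Equiv.swap_apply_right, Equiv.apply_symm_apply, Equiv.apply_symm_apply, Equiv.swap_apply_right]
      · rw [Equiv.swap_apply_of_ne_of_ne h1 h2, Equiv.swap_apply_of_ne_of_ne]
        · intro h; exact h1 (by rw [← h, Equiv.symm_apply_apply])
        · intro h; exact h2 (by rw [← h, Equiv.symm_apply_apply])
  -- double sums over sites transported along `e`
  have htrans : ∀ Φ : V → V → ℝ, ∑ v, ∑ w, Φ v w = ∑ x : Fin N, ∑ y : Fin N, Φ (e.symm x) (e.symm y) := by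
    intro Φ
    refine Fintype.sum_equiv e (fun v => ∑ w, Φ v w) (fun x => ∑ y, Φ (e.symm x) (e.symm y)) fun v => ?_
    rw [Equiv.symm_apply_apply]
    exact Fintype.sum_equiv e (fun w => Φ v w) (fun y => Φ v (e.symm y)) fun w => by rw [Equiv.symm_apply_apply]
  -- the stirring lift: label the particles of `σ₁`, permute the labels, read the occupations
  let occ : Equiv.Perm (Fin N) → (V → Fin 2) := fun τ v => σ₁ (e.symm (τ.symm (e v)))
  have hocc_one : occ 1 = σ₁ := by
    funext v
    show σ₁ (e.symm ((1 : Equiv.Perm (Fin N)).symm (e v))) = σ₁ v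
    rw [← Equiv.Perm.inv_def, inv_one, Equiv.Perm.one_apply, Equiv.symm_apply_apply]
  have hocc_swap : ∀ (i j : Fin N) (τ : Equiv.Perm (Fin N)),
      occ (Equiv.swap i j * τ) = occ τ ∘ ⇑(Equiv.swap (e.symm i) (e.symm j)) := by
    intro i j τ
    funext v
    show σ₁ (e.symm ((Equiv.swap i j * τ).symm (e v))) = σ₁ (e.symm (τ.symm (e (Equiv.swap (e.symm i) (e.symm j) v))))
    rw [hconj, Equiv.Perm.mul_def, Equiv.symm_trans_apply, Equiv.symm_swap]
  have hocc_card : ∀ τ, zerosCard (occ τ) = zerosCard σ₁ := by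
    intro τ
    have h : occ τ = σ₁ ∘ ⇑(e.trans (τ.symm.trans e.symm)) := by
      funext v
      simp [occ]
    rw [h, zerosCard_comp_perm]
  -- fibre multiplicities of the lift
  let m : (V → Fin 2) → ℝ := fun σ => ((Finset.univ.filter fun τ : Equiv.Perm (Fin N) => occ τ = σ).card : ℝ)
  have hsum : ∀ F : (V → Fin 2) → ℝ, ∑ τ, F (occ τ) = ∑ σ, m σ * F σ := by
    intro F
    rw [← Finset.sum_fiberwise_of_maps_to (s := Finset.univ) (t := Finset.univ) (g := occ)
      (fun τ _ => Finset.mem_univ _) (fun τ => F (occ τ))]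
    refine Finset.sum_congr rfl fun σ _ => ?_
    rw [Finset.sum_congr rfl (fun τ hτ => by rw [(Finset.mem_filter.mp hτ).2] :
      ∀ τ ∈ Finset.univ.filter (fun τ => occ τ = σ), F (occ τ) = F σ), Finset.sum_const, nsmul_eq_mul]
  -- the multiplicity is invariant under every transposition of sites …
  have hm_swap : ∀ (x y : V) (σ : V → Fin 2), m (σ ∘ ⇑(Equiv.swap x y)) = m σ := by
    intro x y σ
    have hcard : (Finset.univ.filter fun τ : Equiv.Perm (Fin N) => occ τ = σ).card
        = (Finset.univ.filter fun τ : Equiv.Perm (Fin N) => occ τ = σ ∘ ⇑(Equiv.swap x y)).card := by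
      refine Finset.card_equiv (Equiv.mulLeft (Equiv.swap (e x) (e y))) fun τ => ?_
      simp only [Finset.mem_filter, Finset.mem_univ, true_and, Equiv.coe_mulLeft]
      rw [hocc_swap, Equiv.symm_apply_apply, Equiv.symm_apply_apply]
      constructor
      · intro h
        rw [h]
      · intro h
        funext v
        have hv := congrFun h (Equiv.swap x y v)
        simpa [Function.comp_apply, Equiv.swap_apply_self] using hv
    simp only [m, hcard]
  -- … hence constant on particle-number sectors, positive on the sector of `σ₁`, zero off it
  have hm_const := const_on_sector_of_swapInvariant m hm_swap
  set c : ℝ := m σ₁ with hc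
  have hc_pos : 0 < c := by
    have h1 : (1 : Equiv.Perm (Fin N)) ∈ Finset.univ.filter (fun τ : Equiv.Perm (Fin N) => occ τ = σ₁) := by
      simp [hocc_one]
    have h2 : 0 < (Finset.univ.filter fun τ : Equiv.Perm (Fin N) => occ τ = σ₁).card := Finset.card_pos.mpr ⟨1, h1⟩
    simp only [hc, m]
    exact_mod_cast h2
  have hsumS : ∀ F : (V → Fin 2) → ℝ, (∀ σ, zerosCard σ ≠ n → F σ = 0) →
      ∑ τ, F (occ τ) = c * ∑ σ, F σ := by
    intro F hF
    rw [hsum, Finset.mul_sum]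
    refine Finset.sum_congr rfl fun σ _ => ?_
    by_cases hσ : zerosCard σ = n
    · rw [hm_const σ σ₁ (hσ.trans hn.symm)]
    · have hm0 : m σ = 0 := by
        simp only [m]
        rw [Nat.cast_eq_zero, Finset.card_eq_zero, Finset.filter_eq_empty_iff]
        intro τ _ hτ
        exact hσ (by rw [← hτ, hocc_card τ, hn])
      rw [hF σ hσ, hm0, mul_zero, mul_zero]
  -- the lifted function, its mean, norm and Dirichlet form
  let f : Equiv.Perm (Fin N) → ℂ := fun τ => ((ψ (occ τ) : ℝ) : ℂ)
  let D : V → V → ℝ := fun v w => ∑ σ, (ψ σ - ψ (σ ∘ ⇑(Equiv.swap v w))) ^ 2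
  have hf_mean : ∑ τ, f τ = 0 := by
    simp only [f]
    rw [← Complex.ofReal_sum, hsumS ψ hψoff, hmean, mul_zero, Complex.ofReal_zero]
  have hf_norm : l2NormSq f = c * ∑ σ, ψ σ ^ 2 := by
    simp only [l2NormSq, f, Complex.norm_real, Real.norm_eq_abs, sq_abs]
    exact hsumS (fun σ => ψ σ ^ 2) (fun σ hσ => by rw [hψoff σ hσ]; ring)
  have hf_dir : ∀ i j : Fin N, transpDirichlet i j f = c * D (e.symm i) (e.symm j) := by
    intro i j
    simp only [transpDirichlet, f]
    have hτ : ∀ τ : Equiv.Perm (Fin N), ‖((ψ (occ (Equiv.swap i j * τ)) : ℝ) : ℂ) - ((ψ (occ τ) : ℝ) : ℂ)‖ ^ 2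
        = (fun σ => (ψ σ - ψ (σ ∘ ⇑(Equiv.swap (e.symm i) (e.symm j)))) ^ 2) (occ τ) := by
      intro τ
      rw [← Complex.ofReal_sub, Complex.norm_real, Real.norm_eq_abs, sq_abs, hocc_swap]
      ring
    rw [Finset.sum_congr rfl fun τ _ => hτ τ]
    refine hsumS (fun σ => (ψ σ - ψ (σ ∘ ⇑(Equiv.swap (e.symm i) (e.symm j)))) ^ 2) fun σ hσ => ?_
    have h1 : ψ σ = 0 := hψoff σ hσ
    have h2 : ψ (σ ∘ ⇑(Equiv.swap (e.symm i) (e.symm j))) = 0 :=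
      hψoff _ (by rw [zerosCard_comp_perm]; exact hσ)
    simp only [h1, h2, sub_zero]
    ring
  have hD_symm : ∀ v w : V, D v w = D w v := by
    intro v w
    simp only [D, Equiv.swap_comm]
  -- the rates of the stirring process: `½` per edge
  let A : Fin N → Fin N → ℝ := fun i j => if G.Adj (e.symm i) (e.symm j) then (1 / 2 : ℝ) else 0
  have hA : ∀ i j, 0 ≤ A i j := by
    intro i j
    simp only [A]
    split_ifs <;> norm_num
  have hA_symm : ∀ i j, A i j = A j i := by
    intro i j
    simp only [A, G.adj_comm]
  have hA_diag : ∀ i, A i i = 0 := by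
    intro i
    simp only [A, SimpleGraph.irrefl, if_false]
  -- the random-walk gap of these rates is at least `t`
  have hgap : t ≤ sInf ((fun φ : Fin N → ℂ => (∑ x : Fin N, ∑ y : Fin N with x < y, A x y * ‖φ x - φ y‖ ^ 2)
      / l2NormSq φ) '' {φ : Fin N → ℂ | ∑ x, φ x = 0 ∧ φ ≠ 0}) := by
    refine le_gapRW hV fun φ hφ hφ0 => ?_
    rw [le_div_iff₀ ((Literature.RepresentationTheory.FiniteGroups.l2NormSq_pos_iff φ).mpr hφ0)]
    -- transport the one-particle inequality along `e`
    have hg := hRW (fun v => φ (e v))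
      (by rw [Fintype.sum_equiv e (fun v => φ (e v)) φ (fun v => rfl)]; exact hφ)
    have hnorm : ∑ v, ‖φ (e v)‖ ^ 2 = l2NormSq φ := by
      simp only [l2NormSq]
      exact Fintype.sum_equiv e (fun v => ‖φ (e v)‖ ^ 2) (fun i => ‖φ i‖ ^ 2) (fun v => rfl)
    have hpt : ∀ x y : Fin N,
        A x y * ‖φ x - φ y‖ ^ 2 = (1 / 2 : ℝ) * (if G.Adj (e.symm x) (e.symm y) then ‖φ x - φ y‖ ^ 2 else 0) := by
      intro x y
      simp only [A]
      split_ifs <;> ring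
    have hform : (1 / 4 : ℝ) * ∑ v, ∑ w, (if G.Adj v w then ‖φ (e v) - φ (e w)‖ ^ 2 else 0)
        = ∑ x : Fin N, ∑ y : Fin N with x < y, A x y * ‖φ x - φ y‖ ^ 2 := by
      rw [sum_sum_filter_lt_eq_half (fun x y => A x y * ‖φ x - φ y‖ ^ 2)
        (fun x y => by rw [hA_symm, norm_sub_rev]) (fun x => by rw [hA_diag, zero_mul])]
      rw [htrans (fun v w => if G.Adj v w then ‖φ (e v) - φ (e w)‖ ^ 2 else 0)]
      simp only [Equiv.apply_symm_apply, hpt, ← Finset.mul_sum]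
      ring
    rw [← hnorm, ← hform]
    exact hg
  -- CLR on `𝔖_N`
  have hclr := clr_spectralGap N A hA f hf_mean
  -- the right-hand side of CLR is `c · ⟨ψ, A ψ⟩`
  have hrhs : (∑ x : Fin N, ∑ y : Fin N with x < y, A x y * (transpDirichlet x y f / 2))
      = c * ∑ σ, ψ σ * fmOp G ψ σ := by
    have hpt : ∀ x y : Fin N, A x y * (transpDirichlet x y f / 2)
        = (c / 4) * (if G.Adj (e.symm x) (e.symm y) then D (e.symm x) (e.symm y) else 0) := by
      intro x y
      rw [hf_dir]
      simp only [A]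
      split_ifs <;> ring
    rw [sum_sum_filter_lt_eq_half (fun x y => A x y * (transpDirichlet x y f / 2))
      (fun x y => by rw [hA_symm, transpDirichlet_comm]) (fun x => by rw [hA_diag, zero_mul])]
    simp only [hpt]
    rw [← htrans (fun v w => (c / 4) * (if G.Adj v w then D v w else 0)), inner_fmOp_eq]
    simp only [D, ← Finset.mul_sum]
    ring
  -- assemble: `t · c · Σψ² ≤ gap · ‖f‖² ≤ 𝓔_A(f) = c · ⟨ψ, Aψ⟩`
  have hψ2 : 0 ≤ ∑ σ, ψ σ ^ 2 := Finset.sum_nonneg fun σ _ => sq_nonneg _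
  have key : t * (c * ∑ σ, ψ σ ^ 2) ≤ c * ∑ σ, ψ σ * fmOp G ψ σ := by
    calc t * (c * ∑ σ, ψ σ ^ 2)
        ≤ sInf ((fun φ : Fin N → ℂ => (∑ x : Fin N, ∑ y : Fin N with x < y, A x y * ‖φ x - φ y‖ ^ 2)
            / l2NormSq φ) '' {φ : Fin N → ℂ | ∑ x, φ x = 0 ∧ φ ≠ 0}) * (c * ∑ σ, ψ σ ^ 2) :=
          mul_le_mul_of_nonneg_right hgap (mul_nonneg hc_pos.le hψ2)
      _ = sInf ((fun φ : Fin N → ℂ => (∑ x : Fin N, ∑ y : Fin N with x < y, A x y * ‖φ x - φ y‖ ^ 2)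
            / l2NormSq φ) '' {φ : Fin N → ℂ | ∑ x, φ x = 0 ∧ φ ≠ 0}) * l2NormSq f := by rw [hf_norm]
      _ ≤ ∑ x : Fin N, ∑ y : Fin N with x < y, A x y * (transpDirichlet x y f / 2) := hclr
      _ = c * ∑ σ, ψ σ * fmOp G ψ σ := hrhs
  have key' : c * (t * ∑ σ, ψ σ ^ 2) ≤ c * ∑ σ, ψ σ * fmOp G ψ σ := by linarith
  exact le_of_mul_le_mul_left key' hc_pos

end General

/-! ## The torus: `FerroSectorGapCLR` holds -/

variable {L : ℕ} [NeZero L]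

/-- **Exclusion Poincaré inequality on `(ℤ/L)²`, `L ≥ 3`:** every real amplitude supported on the sector `Sᶻ_tot = M`
with `Σ_σ ψ σ = 0` has `(1 − cos(2π/L)) Σ ψ² ≤ ⟨ψ, A ψ⟩`. [cite: CaputoLiggettRichthammer2010, Theorem 1.1] -/
theorem exclusionGap_torus (hL : 3 ≤ L) (M : ℝ) (ψ : TensorIndex (TorusSite 2 L) 2 → ℝ)
    (hsupp : ∀ σ, ψ σ ≠ 0 → zerosCard σ = (Fintype.card (TorusSite 2 L) : ℝ) / 2 + M)
    (hmean : ∑ σ, ψ σ = 0) :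
    (1 - Real.cos (2 * Real.pi / L)) * ∑ σ, ψ σ ^ 2 ≤ ∑ σ, ψ σ * fmOp (torusGraph 2 L) ψ σ := by
  have hcard : Fintype.card (TorusSite 2 L) = L ^ 2 := by simp [ZMod.card]
  have hV : 2 ≤ Fintype.card (TorusSite 2 L) := by
    rw [hcard]
    nlinarith
  exact exclusion_poincare_of_rw_gap (torusGraph 2 L) hV _ (fun g hg => torus_poincare_adj hL g hg) _ ψ hsupp hmean

/-- **`FerroSectorGapCLR` HOLDS** (the SEP / Aldous sector gap of `H(1)` on the `L × L` torus, `L ≥ 3`, in the tree's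
Temple-form vocabulary): for every sector `M`, every Perron sector ground amplitude `a` and every real unit amplitude `φ`
of the sector, `(1 − cos(2π/L)) (1 − ⟨a, φ⟩²) ≤ ⟨φ, H(1) φ⟩ − E(M)`.  Caputo–Liggett–Richthammer 2010, Thm 1.1 (tree
`clr_spectralGap`) + projection to the exclusion process + the one-magnon gap of the torus + the `Δ = 1` dictionary.
[cite: CaputoLiggettRichthammer2010, Theorem 1.1] -/
theorem ferroSectorGapCLR_holds : FerroSectorGapCLR := by
  intro L hL _ M
  exact sectorGapAtLeast_one_of_exclusionGap M _ (fun ψ hs hm => exclusionGap_torus hL M ψ hs hm)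

end Summit.HubbardSuperconductivity.HubbardSuperconductivity.Theorems.AnisotropyChord.Transfer

end
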